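/-!
# KR-FREE finite facts F5, F35, F55, F65, F85, F95 — kernel-checked (`HodgeFermat/KRFreeFacts.lean`; HF-G19a)

Tree copy (whole module) of the module `HodgeFermat/KRFreeFacts.lean` of the sibling cell's standalone package
`run/shared/lean/pub/pub-hodgefermat/lean/HodgeFermat/` (207 lines, sha256 `dda294e0ece897f3…`), source lines 31–207 (all: the executable model `units`/`triples`/`inType`/`cmMask`, the merge-sort certificate and its soundness, the facts `F5`, `F35`, `F55`, `F65`, `F85`, `F95` by `decide +kernel`, the control counts).
Filed by cell `pub-hfermat`, seat prover-1 gen-3, on the COORDINATOR KEEPER RULING of 2026-08-25 (gem sweep H1: take the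
off-gate kernel theorem `thmFstar` through the gate) — here THEOREM F* of `tables/DPRIME-THEOREM.md` §9 IN FULL, i.e.
PROPOSITION D′(3N) and the descent (`HodgeFermat/PropDPrimeNFinal.lean`, GATE HF-G34), the last off-gate form of THEOREM F*
(its first two forms, `DecodingFinal.thmFstar` = F* at the prime levels and `ThmFstarNFinal.thmFstar` = F*(3N), landed on
2026-08-25 as `HodgeFermatThmFstar.lean` / `HodgeFermatThmFstarN.lean`, seats prover-1 gen-0 / gen-2); this file is one link of
the import closure of `PropDPrimeNFinal.propDprime` (the sibling's KR-free chain: THEOREM L, COROLLARY M, THEOREM D6,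
THEOREM U⁺, THEOREM KR6, THEOREM Z3U) on top of those landed chains.  The source module is the sibling's hub-checked module of
record (pub-hodgefermat `CERT.md` l.861, GATE HF-G19a; core Lean only, no imports, exactly as the source); its declarations are copied VERBATIM.
Deviations from the source module, exhaustively: the `import` lines (tree modules `Summits.HodgeConjecture.FermatCycles.
HodgeFermat*` instead of `HodgeFermat.*`); this module docstring; NO import line, exactly as the source (core Lean only); the source's `set_option maxRecDepth`/`set_option maxHeartbeats … in` lines are kept verbatim (kernel evaluation of the six certificates); one-line docstrings added (gate lint) to `merge_perm`, `deal_perm`, `msort_perm`, `incr_pairwise`, `incr_nodup`, `inj_of_nodup_map`, `F5`, `F35`, `F55`, `F65`, `F85`, `F95`, `pairCount`, `control_counts_35`, `control_counts_95`, `control_level15`, `control_level21`, `control_level39`, `control_level45`, `control_level57`, `control_level35`.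
Every other line — in particular every declaration's statement and proof — is byte-identical to the source.
HONEST FRAMING: explicit algebraic cycles for specific Hodge classes on Fermat/Delsarte varieties; residual open instances
listed; no claim on general Hodge.  (This file is arithmetic of CM types / finite combinatorics / analytic number theory
of the sibling's KR-free programme; it claims nothing about cycles.)

The source module's docstring (KRFreeFacts.lean l.1–29), verbatim:

## KR-FREE finite facts F5, F35, F55, F65, F85, F95 — kernel-checked (build hodge-fermat, generation 19)

`tables/KR-FREE.md` (THEOREM D6: no two distinct triples of a squarefree level prime to 6 share a CM type)
uses six finite scan facts: at each level N ∈ {5, 35, 55, 65, 85, 95} no two distinct triples have the same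
CM type (established there by ≥ 3 independent enumerations).  This file states them over an executable model
of `SEMI-THEOREM.md` §0 and proves them by `decide +kernel`: the Lean KERNEL evaluates a duplicate-freeness
certificate (merge-sort the CM-type bitmasks, check strict increase), and the soundness of the certificate
(sorted output is a permutation of the input; strictly increasing ⇒ no duplicates; no duplicate masks ⇒ equal
masks force equal triples) is proved below from core lemmas.  No imports (core Lean only, toolchain
leanprover/lean4:v4.32.0), no `sorry`, no `native_decide` / `Lean.ofReduceBool`, no `Classical.choice`:
`#print axioms F95` lists exactly `[propext, Quot.sound]` (from the core permutation lemmas).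
Checked with the hub's `lean check` (75 s for the whole file); planted controls (a false certificate
`coincidenceFreeCert 21 = true`, a false count `pairCount 15 = 41`) are rejected by the kernel
("decide proved that the proposition … is false").  Not imported by the root module `HodgeFermat.lean`
(the facts are inputs of the hand proof in `tables/KR-FREE.md`, not of the lattice theorems); build it with
`lake build HodgeFermat.KRFreeFacts`.

Model (SEMI §0).  Level `N` odd.  A triple is `(a, b, c)` with `1 ≤ a ≤ b ≤ c ≤ N - 1` and `N ∣ a + b + c`
(each multiset of non-zero residues summing to zero exactly once).  For a unit `t` the carry
`(⟨ta⟩ + ⟨tb⟩ + ⟨tc⟩)/N ∈ {1, 2}` equals `1` iff `⟨ta⟩ + ⟨tb⟩ < N` (as `⟨tc⟩ ≠ 0`).  The CM type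
`H_T = {t unit : carry = 1}` is encoded by `cmMask N T = Σ_i 2^i·[t_i ∈ H_T]` over the increasing list of units
`t_0 < t_1 < …`; the encoding is injective on subsets of the units, so `H_T = H_T' ↔ cmMask N T = cmMask N T'`.

Cross-validation of the model against the build's Python implementations (`code/gen14/coinc2.py`,
`code/gen18/coinc18.py`, `code/gen18/scan/coinc_np.py`, `code/gen19/krfree/coinc19.py`): the kernel-computed
numbers of triples and of class-mate pairs at the levels 15, 21, 39, 45, 57 (42, 66, 48, 72, 54 pairs) agree
with theirs — see the `control_*` theorems at the end.
-/

namespace HodgeFermat.KRFree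

/-! ## The model -/

/-- the units of `ℤ/N`: `t ∈ [1, N-1]` with `gcd(t, N) = 1`, increasing -/
def units (N : Nat) : List Nat :=
  (List.range N).filter fun t => t ≠ 0 ∧ Nat.gcd t N = 1

/-- the triples of level `N`: `(a, b, c)`, all in `[1, N-1]`, `a ≤ b ≤ c`, `N ∣ a + b + c` -/
def triples (N : Nat) : List (Nat × Nat × Nat) :=
  (List.range N).flatMap fun a =>
    (List.range N).flatMap fun b =>
      let c := (2 * N - a - b) % N
      if a ≠ 0 ∧ b ≠ 0 ∧ c ≠ 0 ∧ a ≤ b ∧ b ≤ c then [(a, b, c)] else []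

/-- `t ∈ H_T` for `T = (a, b, c)`: the carry is `1` iff `⟨ta⟩_N + ⟨tb⟩_N < N` -/
def inType (N : Nat) (T : Nat × Nat × Nat) (t : Nat) : Bool :=
  (t * T.1) % N + (t * T.2.1) % N < N

/-- the CM type of `T` as a bitmask over `units N` (bit `i` ↔ the `i`-th unit) -/
def cmMask (N : Nat) (T : Nat × Nat × Nat) : Nat :=
  ((units N).foldl (fun (acc : Nat × Nat) t =>
      (if inType N T t then acc.1 + acc.2 else acc.1, 2 * acc.2)) (0, 1)).1

/-- the list of CM-type masks of all triples of level `N` -/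
def masks (N : Nat) : List Nat := (triples N).map (cmMask N)

/-- no two distinct triples of level `N` have the same CM type -/
def CoincidenceFree (N : Nat) : Prop :=
  ∀ T ∈ triples N, ∀ T' ∈ triples N, cmMask N T = cmMask N T' → T = T'

/-! ## A kernel-reducible duplicate-freeness certificate: fuelled merge sort + strict increase -/

/-- merge with fuel (structurally recursive in the fuel; when the fuel runs out the rest is appended unsorted,
which keeps the output a permutation of the input) -/
def merge : Nat → List Nat → List Nat → List Nat
  | 0, l₁, l₂ => l₁ ++ l₂
  | _ + 1, [], l₂ => l₂
  | _ + 1, a :: l₁, [] => a :: l₁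
  | f + 1, a :: l₁, b :: l₂ =>
      if a ≤ b then a :: merge f l₁ (b :: l₂) else b :: merge f (a :: l₁) l₂

/-- deal the elements alternately onto two lists -/
def deal : List Nat → List Nat × List Nat
  | [] => ([], [])
  | a :: l => (a :: (deal l).2, (deal l).1)

/-- merge sort with fuel (structurally recursive in the fuel) -/
def msort : Nat → List Nat → List Nat
  | 0, l => l
  | _ + 1, [] => []
  | _ + 1, [a] => [a]
  | f + 1, a :: b :: l =>
      merge (l.length + 2) (msort f (deal (a :: b :: l)).1) (msort f (deal (a :: b :: l)).2)

/-- strictly increasing -/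
def incr : List Nat → Bool
  | a :: b :: l => decide (a < b) && incr (b :: l)
  | _ => true

/-- the certificate: the sorted mask list of level `N` is strictly increasing -/
def coincidenceFreeCert (N : Nat) : Bool :=
  incr (msort (masks N).length (masks N))

/-! ## Soundness of the certificate -/

/-- the fuelled `merge` returns a permutation of `l₁ ++ l₂` -/
theorem merge_perm : ∀ (f : Nat) (l₁ l₂ : List Nat), (merge f l₁ l₂).Perm (l₁ ++ l₂)
  | 0, l₁, l₂ => by simp [merge]
  | _ + 1, [], l₂ => by simp [merge]
  | _ + 1, a :: l₁, [] => by simp [merge]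
  | f + 1, a :: l₁, b :: l₂ => by
      simp only [merge]
      split
      · exact (merge_perm f l₁ (b :: l₂)).cons a
      · have ih := (merge_perm f (a :: l₁) l₂).cons b
        have hm : ((a :: l₁) ++ b :: l₂).Perm (b :: ((a :: l₁) ++ l₂)) := List.perm_middle
        exact ih.trans hm.symm

/-- `deal` splits a list into two whose concatenation is a permutation of it -/
theorem deal_perm : ∀ (l : List Nat), ((deal l).1 ++ (deal l).2).Perm l
  | [] => by simp [deal]
  | a :: l => by
      simp only [deal, List.cons_append]
      exact ((List.perm_append_comm).trans (deal_perm l)).cons a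

/-- the fuelled merge sort returns a permutation of its input -/
theorem msort_perm : ∀ (f : Nat) (l : List Nat), (msort f l).Perm l
  | 0, l => by simp [msort]
  | _ + 1, [] => by simp [msort]
  | _ + 1, [a] => by simp [msort]
  | f + 1, a :: b :: l => by
      simp only [msort]
      refine (merge_perm _ _ _).trans ?_
      exact ((msort_perm f _).append (msort_perm f _)).trans (deal_perm (a :: b :: l))

/-- a list passing `incr` is strictly increasing -/
theorem incr_pairwise : ∀ (l : List Nat), incr l = true → l.Pairwise (· < ·)
  | [], _ => List.Pairwise.nil
  | [a], _ => by simp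
  | a :: b :: l, h => by
      simp only [incr, Bool.and_eq_true, decide_eq_true_eq] at h
      have ih := incr_pairwise (b :: l) h.2
      refine List.Pairwise.cons ?_ ih
      intro x hx
      rcases List.mem_cons.mp hx with rfl | hx'
      · exact h.1
      · exact Nat.lt_trans h.1 (List.rel_of_pairwise_cons ih hx')

/-- a list passing `incr` has no duplicates -/
theorem incr_nodup (l : List Nat) (h : incr l = true) : l.Nodup :=
  (incr_pairwise l h).imp (fun hlt => Nat.ne_of_lt hlt)

/-- if `l.map f` has no duplicates then `f` is injective on `l` -/
theorem inj_of_nodup_map {α β : Type} (f : α → β) :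
    ∀ (l : List α), (l.map f).Nodup → ∀ x ∈ l, ∀ y ∈ l, f x = f y → x = y
  | [], _, x, hx, _, _, _ => by simp at hx
  | a :: l, h, x, hx, y, hy, hxy => by
      rw [List.map_cons, List.nodup_cons] at h
      rcases List.mem_cons.mp hx with rfl | hx'
      · rcases List.mem_cons.mp hy with rfl | hy'
        · rfl
        · exact absurd (List.mem_map.mpr ⟨y, hy', hxy.symm⟩) h.1
      · rcases List.mem_cons.mp hy with rfl | hy'
        · exact absurd (List.mem_map.mpr ⟨x, hx', hxy⟩) h.1
        · exact inj_of_nodup_map f l h.2 x hx' y hy' hxy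

/-- soundness: if the certificate evaluates to `true`, level `N` is coincidence-free -/
theorem coincidenceFree_of_cert {N : Nat} (h : coincidenceFreeCert N = true) : CoincidenceFree N := by
  have hnd : (masks N).Nodup :=
    (msort_perm _ _).nodup_iff.mp (incr_nodup _ h)
  exact inj_of_nodup_map (cmMask N) (triples N) hnd

/-! ## The six facts (kernel evaluation) -/

set_option maxRecDepth 100000

/-- F5: no two distinct triples of level 5 share a CM type (kernel) -/
theorem F5 : CoincidenceFree 5 := coincidenceFree_of_cert (by decide +kernel)

set_option maxHeartbeats 4000000 in
/-- F35: no two distinct triples of level 35 share a CM type (kernel) -/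
theorem F35 : CoincidenceFree 35 := coincidenceFree_of_cert (by decide +kernel)

set_option maxHeartbeats 40000000 in
/-- F55: no two distinct triples of level 55 share a CM type (kernel) -/
theorem F55 : CoincidenceFree 55 := coincidenceFree_of_cert (by decide +kernel)

set_option maxHeartbeats 40000000 in
/-- F65: no two distinct triples of level 65 share a CM type (kernel) -/
theorem F65 : CoincidenceFree 65 := coincidenceFree_of_cert (by decide +kernel)

set_option maxHeartbeats 40000000 in
/-- F85: no two distinct triples of level 85 share a CM type (kernel) -/
theorem F85 : CoincidenceFree 85 := coincidenceFree_of_cert (by decide +kernel)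

set_option maxHeartbeats 40000000 in
/-- F95: no two distinct triples of level 95 share a CM type (kernel) -/
theorem F95 : CoincidenceFree 95 := coincidenceFree_of_cert (by decide +kernel)

/-! ## Controls: the model sees the coincidences where they exist, with the build's pair counts -/

/-- number of class-mate pairs: Σ over runs of equal values in the sorted mask list of r(r-1)/2,
computed as Σ_i #{j < i : m_j = m_i} along the sorted list -/
def runPairs : List Nat → Nat → Nat → Nat
  -- runPairs l prev k : `k` = length of the current run of value `prev` seen so far
  | [], _, _ => 0
  | a :: l, prev, k => if a = prev then k + runPairs l a (k + 1) else runPairs l a 1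

/-- the number of class-mate pairs of level `N` (control quantity) -/
def pairCount (N : Nat) : Nat :=
  match msort (masks N).length (masks N) with
  | [] => 0
  | a :: l => runPairs l a 1

/-- control: 24 units and 204 triples at level 35 -/
theorem control_counts_35 : (units 35).length = 24 ∧ (triples 35).length = 204 := by decide +kernel
/-- control: 72 units and 1504 triples at level 95 -/
theorem control_counts_95 : (units 95).length = 72 ∧ (triples 95).length = 1504 := by decide +kernel
set_option maxHeartbeats 4000000 in
/-- control: level 15 is NOT coincidence-free, 42 class-mate pairs -/
theorem control_level15 : coincidenceFreeCert 15 = false ∧ pairCount 15 = 42 := by decide +kernel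
set_option maxHeartbeats 4000000 in
/-- control: level 21 is NOT coincidence-free, 66 class-mate pairs -/
theorem control_level21 : coincidenceFreeCert 21 = false ∧ pairCount 21 = 66 := by decide +kernel
set_option maxHeartbeats 40000000 in
/-- control: 48 class-mate pairs at level 39 -/
theorem control_level39 : pairCount 39 = 48 := by decide +kernel
set_option maxHeartbeats 40000000 in
/-- control: 72 class-mate pairs at level 45 -/
theorem control_level45 : pairCount 45 = 72 := by decide +kernel
set_option maxHeartbeats 40000000 in
/-- control: 54 class-mate pairs at level 57 -/
theorem control_level57 : pairCount 57 = 54 := by decide +kernel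
/-- control: 0 class-mate pairs at level 35 -/
theorem control_level35 : pairCount 35 = 0 := by decide +kernel

end HodgeFermat.KRFree
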